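import Literature.LinearAlgebra.Matrix.LoewnerHeinzInequality
import Literature.LinearAlgebra.Matrix.AbsoluteValueCauchySchwarz
import Literature.LinearAlgebra.Matrix.BlockGramDeterminantInequalities
import Literature.LinearAlgebra.Matrix.NumericalRadiusShiftExamples
import Mathlib.Analysis.MeanInequalitiesPow
import HarnessLib

/-!
# The Hölder–McCarthy inequality `⟨Sx, x⟩ʳ ≤ ⟨Sʳx, x⟩` (`r ≥ 1`), `⟨Sʳx, x⟩ ≤ ⟨Sx, x⟩ʳ` (`0 ≤ r ≤ 1`) for `S ⪰ 0`
# and unit `x`, and Kittaneh's numerical radius bound `|⟨Tx, x⟩|² ≤ ½⟨(T^*T + TT^*)x, x⟩ ≤ ½‖T^*T + TT^*‖`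

[cite: Alomari2019, Lemma 2.1 (eq. (2.1), (2.2)) and eq. (1.9) (held text `paper:arxiv-1912.01492`, pp. 3–5);
Kittaneh2005, Thm 1]

DISAMBIGUATION. Nothing in the tree states the Hölder–McCarthy (operator Jensen) inequality for quadratic forms
(`rg -i mccarthy` over `Literature/` finds only an unrelated random-walk paper); the tree's numerical-radius files are
`Literature/Analysis/InnerProduct/NumericalRadiusPower.lean` (Berger–Pearcy `w(Tⁿ) ≤ w(T)ⁿ`, `‖T‖ ≤ 2w(T)`),
`ToeplitzHausdorff.lean`, and `NumericalRadiusShiftExamples.lean` (Zhang § 3.6: `ρ ≤ w ≤ σ_max`, the `4 × 4` shift),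
whose DEF-FREE conventions are kept: a unit vector is `star x ⬝ᵥ x = 1`, `⟨Ax, x⟩ = star x ⬝ᵥ (A *ᵥ x)`, a bound
`w(A) ≤ c` is «`‖star x ⬝ᵥ (A *ᵥ x)‖ ≤ c` for all unit `x`», and `‖A‖ = σ_max(A)` is the `ℓ²`-operator norm of
`x ↦ Ax` on `EuclideanSpace ℂ n` written `‖(toEuclideanLin.trans LinearMap.toContinuousLinearMap) A‖` as in
`norm_star_dotProduct_mulVec_le_l2_opNorm` there.  Reused by import: the mixed Schwarz inequality at `α = 1/2`
`|⟨Tx, y⟩|² ≤ ⟨|T|x, x⟩⟨|T^*|y, y⟩` (`AbsoluteValueCauchySchwarz.norm_sq_inner_le_abs_mul_abs_conjTranspose`, Zhang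
Thm 8.4), the Gram block `[[M^*M, M^*N], [N^*M, N^*N]] ⪰ 0` (`BlockGramDet.posSemidef_fromBlocks_gram`) with Horn–Johnson
7.7.11 (`norm_sq_le_of_fromBlocks_posSemidef`), the diagonal form `Aʳ = U diag(λᵏʳ) U^*`
(`LoewnerHeinzInequality.rpow_eq_conj_diagonal`), and Mathlib's weighted power-mean (Jensen) inequality
`Real.rpow_arith_mean_le_arith_mean_rpow`.  §§ 1–3 over `𝕜 = ℝ` or `ℂ`; the operator-norm form in § 3 over `ℂ`.

Source, VERBATIM — M. W. Alomari, *Improvements of some numerical radius inequalities*, arXiv:1912.01492 (2019)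
[Alomari2019] (held text, pp. 3–5): «In 1952, Kato [TK] introduced a companion inequality of (1.1), called the mixed
Schwarz inequality, which asserts `|⟨Ax, y⟩|² ≤ ⟨|A|^{2α}x, x⟩⟨|A^*|^{2(1−α)}y, y⟩`, `0 ≤ α ≤ 1`. … After that in
2005, the same author [Kittaneh] in [FK2] proved that `¼‖A^*A + AA^*‖ ≤ w²(A) ≤ ½‖A^*A + AA^*‖.` (1.9) The inequality
is sharp. … **Lemma 2.1.** Let `S ∈ B(H)`, `S ≥ 0` and `x ∈ H` be a unit vector. Then, the operator Jensen's
inequality `⟨Sx, x⟩ʳ ≤ ⟨Sʳx, x⟩, r ≥ 1` (2.1) and `⟨Sʳx, x⟩ ≤ ⟨Sx, x⟩ʳ, r ∈ [0, 1]`. (2.2)»  ([FK2] = F. Kittaneh,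
*Numerical radius inequalities for Hilbert space operators*, Studia Math. 168 (2005) 73–80 [Kittaneh2005], Theorem 1.)

## What is proved (all `theorem`s, no `def`)

* § 1 (`𝕜`): `re_quadForm_rpow_eq_sum_eigenvalues` / `re_quadForm_eq_sum_eigenvalues` (`⟨Sʳx, x⟩ = Σ_k λ_kʳ |(U^*x)_k|²`
  for `S ⪰ 0`, from the private identities `x^*(V diag(d) V^*)x = Σ_k d_k |(V^*x)_k|²`, `Σ_k |(V^*x)_k|² = x^*x`).
* § 2 (`𝕜`): **`holderMcCarthy_one_le`** ((2.1): `⟨Sx, x⟩ʳ ≤ ⟨Sʳx, x⟩`, `r ≥ 1`), **`holderMcCarthy_le_one`** ((2.2):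
  `⟨Sʳx, x⟩ ≤ ⟨Sx, x⟩ʳ`, `0 ≤ r ≤ 1`), `re_sq_le_re_mul_self` (`⟨Sx, x⟩² ≤ ⟨S²x, x⟩` for HERMITIAN `S` and unit `x`,
  Cauchy–Schwarz).
* § 3: **`kittaneh_norm_sq_inner_le`** (`𝕜`; for unit `x`, `|⟨Tx, x⟩|² ≤ ½⟨(T^*T + TT^*)x, x⟩` — the pointwise form of
  the right half of (1.9): mixed Schwarz at `α = 1/2`, AM–GM, `⟨(|T| + |T^*|)x, x⟩² ≤ ⟨(|T| + |T^*|)²x, x⟩`, and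
  `(|T| + |T^*|)² ≤ 2(|T|² + |T^*|²)`), and over `ℂ` **`kittaneh_norm_sq_inner_le_l2_opNorm`** (`w²(T) ≤ ½‖T^*T + TT^*‖`
  read def-free: `|⟨Tx, x⟩|² ≤ ½‖T^*T + TT^*‖` for every unit `x`).

NOT covered: the left half `¼‖A^*A + AA^*‖ ≤ w²(A)` of (1.9) and its sharpness; Kittaneh's 2003 bound
`w(T) ≤ ½(‖T‖ + ‖T²‖^{1/2})`.
-/

open Matrix
open scoped ComplexOrder MatrixOrder

namespace Literature.LinearAlgebra.Matrix.HolderMcCarthyInequality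

open Literature.LinearAlgebra.Matrix.LoewnerHeinzInequality
open Literature.LinearAlgebra.Matrix.BlockGramDet (posSemidef_fromBlocks_gram)
open Literature.LinearAlgebra.Matrix.AbsoluteValueCauchySchwarz (norm_sq_inner_le_abs_mul_abs_conjTranspose)

/-! ## § 1. Quadratic forms of diagonalised matrices -/

section General

variable {𝕜 : Type*} [RCLike 𝕜] {n : Type*} [Fintype n] [DecidableEq n]

/-- **`x^*(V diag(d) V^*)x = Σ_k d_k |(V^*x)_k|²`** for real `d` (over `𝕜`; the tree's
`PeierlsOrthonormalFamily.star_dotProduct_conj_diagonal_mulVec` is the `ℂ` statement, in the quantum-lattice corner).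
[cite: Alomari2019, proof of Lemma 2.1 (spectral form of `⟨f(S)x, x⟩`)] -/
private theorem star_dotProduct_conj_diagonal_mulVec' (V : Matrix n n 𝕜) (d : n → ℝ) (x : n → 𝕜) :
    star x ⬝ᵥ ((V * diagonal (fun k => ((d k : ℝ) : 𝕜)) * star V) *ᵥ x) =
      ((∑ k, d k * ‖(Vᴴ *ᵥ x) k‖ ^ 2 : ℝ) : 𝕜) := by
  rw [← mulVec_mulVec, ← mulVec_mulVec, dotProduct_mulVec, star_eq_conjTranspose,
    show star x ᵥ* V = star (Vᴴ *ᵥ x) by rw [star_mulVec, conjTranspose_conjTranspose]]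
  simp only [dotProduct, mulVec_diagonal, Pi.star_apply]
  push_cast
  refine Finset.sum_congr rfl fun k _ => ?_
  rw [RCLike.star_def, mul_left_comm, RCLike.conj_mul]

/-- `Σ_k |(V^*x)_k|² = x^*x` for unitary `V` (over `𝕜`). [folklore] -/
private theorem sum_norm_sq_conjTranspose_mulVec' {V : Matrix n n 𝕜} (hV : V ∈ Matrix.unitaryGroup n 𝕜) (x : n → 𝕜) :
    ((∑ k, ‖(Vᴴ *ᵥ x) k‖ ^ 2 : ℝ) : 𝕜) = star x ⬝ᵥ x := by
  have h := star_dotProduct_conj_diagonal_mulVec' V (fun _ => (1 : ℝ)) x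
  rw [show (fun _ : n => (((1 : ℝ) : ℝ) : 𝕜)) = fun _ => 1 by funext; simp, diagonal_one, Matrix.mul_one,
    Matrix.mem_unitaryGroup_iff.mp hV, one_mulVec] at h
  rw [h]
  simp only [one_mul]

/-- **`⟨Sʳx, x⟩ = Σ_k λ_kʳ |(U^*x)_k|²`** for `S ⪰ 0` with spectral decomposition `S = U diag(λ) U^*`.
[cite: Alomari2019, proof of Lemma 2.1] -/
theorem re_quadForm_rpow_eq_sum_eigenvalues {S : Matrix n n 𝕜} (hS : S.PosSemidef) (r : ℝ) (x : n → 𝕜) :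
    RCLike.re (star x ⬝ᵥ (S ^ r *ᵥ x)) =
      ∑ k, hS.1.eigenvalues k ^ r * ‖((hS.1.eigenvectorUnitary : Matrix n n 𝕜)ᴴ *ᵥ x) k‖ ^ 2 := by
  rw [rpow_eq_conj_diagonal hS.1.eigenvectorUnitary.2 hS.eigenvalues_nonneg hS.1.spectral_theorem r,
    star_dotProduct_conj_diagonal_mulVec', RCLike.ofReal_re]

/-- `⟨Sx, x⟩ = Σ_k λ_k |(U^*x)_k|²` for `S ⪰ 0`. [cite: Alomari2019, proof of Lemma 2.1] -/
theorem re_quadForm_eq_sum_eigenvalues {S : Matrix n n 𝕜} (hS : S.PosSemidef) (x : n → 𝕜) :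
    RCLike.re (star x ⬝ᵥ (S *ᵥ x)) =
      ∑ k, hS.1.eigenvalues k * ‖((hS.1.eigenvectorUnitary : Matrix n n 𝕜)ᴴ *ᵥ x) k‖ ^ 2 := by
  have h := re_quadForm_rpow_eq_sum_eigenvalues hS 1 x
  rw [rpow_one hS] at h
  simpa only [Real.rpow_one] using h

end General

/-! ## § 2. The Hölder–McCarthy inequality -/

section McCarthy

variable {𝕜 : Type*} [RCLike 𝕜] {n : Type*} [Fintype n] [DecidableEq n] {S : Matrix n n 𝕜} {x : n → 𝕜}

/-- **Hölder–McCarthy, `r ≥ 1`: `⟨Sx, x⟩ʳ ≤ ⟨Sʳx, x⟩`** for `S ⪰ 0` and a unit vector `x` (Jensen's inequality for the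
convex `t ↦ tʳ` and the probability weights `|(U^*x)_k|²`). [cite: Alomari2019, Lemma 2.1 (2.1)] -/
theorem holderMcCarthy_one_le (hS : S.PosSemidef) (hx : star x ⬝ᵥ x = 1) {r : ℝ} (hr : 1 ≤ r) :
    RCLike.re (star x ⬝ᵥ (S *ᵥ x)) ^ r ≤ RCLike.re (star x ⬝ᵥ (S ^ r *ᵥ x)) := by
  have hw : ∑ k, ‖((hS.1.eigenvectorUnitary : Matrix n n 𝕜)ᴴ *ᵥ x) k‖ ^ 2 = 1 := by
    have h := sum_norm_sq_conjTranspose_mulVec' hS.1.eigenvectorUnitary.2 x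
    rw [hx] at h
    exact_mod_cast h
  rw [re_quadForm_eq_sum_eigenvalues hS, re_quadForm_rpow_eq_sum_eigenvalues hS]
  have h := Real.rpow_arith_mean_le_arith_mean_rpow (s := Finset.univ)
    (fun k => ‖((hS.1.eigenvectorUnitary : Matrix n n 𝕜)ᴴ *ᵥ x) k‖ ^ 2) (fun k => hS.1.eigenvalues k)
    (fun k _ => sq_nonneg _) hw (fun k _ => hS.eigenvalues_nonneg k) hr
  simpa only [mul_comm] using h

/-- **Hölder–McCarthy, `0 ≤ r ≤ 1`: `⟨Sʳx, x⟩ ≤ ⟨Sx, x⟩ʳ`** for `S ⪰ 0` and a unit vector `x` (the previous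
inequality with exponent `1/r` applied to `Sʳ`). [cite: Alomari2019, Lemma 2.1 (2.2)] -/
theorem holderMcCarthy_le_one (hS : S.PosSemidef) (hx : star x ⬝ᵥ x = 1) {r : ℝ} (hr0 : 0 ≤ r) (hr1 : r ≤ 1) :
    RCLike.re (star x ⬝ᵥ (S ^ r *ᵥ x)) ≤ RCLike.re (star x ⬝ᵥ (S *ᵥ x)) ^ r := by
  rcases eq_or_lt_of_le hr0 with rfl | hr0'
  · rw [rpow_zero hS, one_mulVec, hx, Real.rpow_zero, RCLike.one_re]
  · have h := holderMcCarthy_one_le (posSemidef_rpow S r) hx (r := 1 / r) ((one_le_div hr0').mpr hr1)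
    rw [CFC.rpow_rpow_of_exponent_nonneg S r (1 / r) hr0 (by positivity) hS.nonneg,
      mul_one_div_cancel hr0'.ne', CFC.rpow_one S hS.nonneg] at h
    have hnn : 0 ≤ RCLike.re (star x ⬝ᵥ (S ^ r *ᵥ x)) :=
      (RCLike.nonneg_iff.mp ((posSemidef_rpow S r).dotProduct_mulVec_nonneg x)).1
    calc RCLike.re (star x ⬝ᵥ (S ^ r *ᵥ x)) = (RCLike.re (star x ⬝ᵥ (S ^ r *ᵥ x)) ^ (1 / r)) ^ r := by
          rw [← Real.rpow_mul hnn, one_div_mul_cancel hr0'.ne', Real.rpow_one]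
      _ ≤ RCLike.re (star x ⬝ᵥ (S *ᵥ x)) ^ r := Real.rpow_le_rpow (Real.rpow_nonneg hnn _) h hr0

/-- **`⟨Sx, x⟩² ≤ ⟨S²x, x⟩` for Hermitian `S` and unit `x`** (Cauchy–Schwarz: `|⟨Sx, x⟩|² ≤ ‖Sx‖²‖x‖²`; for `S ⪰ 0`
this is the case `r = 2` of Hölder–McCarthy). [cite: Alomari2019, Lemma 2.1 (2.1) with `r = 2`] -/
theorem re_sq_le_re_mul_self (hS : S.IsHermitian) (hx : star x ⬝ᵥ x = 1) :
    RCLike.re (star x ⬝ᵥ (S *ᵥ x)) ^ 2 ≤ RCLike.re (star x ⬝ᵥ ((S * S) *ᵥ x)) := by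
  have h := norm_sq_le_of_fromBlocks_posSemidef (posSemidef_fromBlocks_gram (1 : Matrix n n 𝕜) S) x x
  rw [conjTranspose_one, Matrix.one_mul, Matrix.one_mul, hS.eq, one_mulVec, hx, RCLike.one_re, one_mul] at h
  exact (sq_le_sq.mpr (by rw [abs_norm]; exact RCLike.abs_re_le_norm _)).trans h

end McCarthy

/-! ## § 3. Kittaneh's bound `w²(T) ≤ ½‖T^*T + TT^*‖` -/

section Kittaneh

variable {𝕜 : Type*} [RCLike 𝕜] {n : Type*} [Fintype n] [DecidableEq n]

/-- **Kittaneh (2005), pointwise form: `|⟨Tx, x⟩|² ≤ ½⟨(T^*T + TT^*)x, x⟩` for every unit vector `x`.**  Road: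
`|⟨Tx, x⟩|² ≤ ⟨|T|x, x⟩⟨|T^*|x, x⟩ ≤ ¼⟨(|T| + |T^*|)x, x⟩² ≤ ¼⟨(|T| + |T^*|)²x, x⟩ ≤ ½⟨(|T|² + |T^*|²)x, x⟩`
(mixed Schwarz, AM–GM, Cauchy–Schwarz, `2(P² + Q²) − (P + Q)² = (P − Q)² ⪰ 0`). [cite: Kittaneh2005, Thm 1;
Alomari2019, eq. (1.9)] -/
theorem kittaneh_norm_sq_inner_le (T : Matrix n n 𝕜) {x : n → 𝕜} (hx : star x ⬝ᵥ x = 1) :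
    ‖star x ⬝ᵥ (T *ᵥ x)‖ ^ 2 ≤ 1 / 2 * RCLike.re (star x ⬝ᵥ ((Tᴴ * T + T * Tᴴ) *ᵥ x)) := by
  have hP : (CFC.sqrt (Tᴴ * T)).PosSemidef := by rw [sqrt_eq_rpow]; exact posSemidef_rpow _ _
  have hQ : (CFC.sqrt (T * Tᴴ)).PosSemidef := by rw [sqrt_eq_rpow]; exact posSemidef_rpow _ _
  have hPP : CFC.sqrt (Tᴴ * T) * CFC.sqrt (Tᴴ * T) = Tᴴ * T :=
    CFC.sqrt_mul_sqrt_self _ (posSemidef_conjTranspose_mul_self T).nonneg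
  have hQQ : CFC.sqrt (T * Tᴴ) * CFC.sqrt (T * Tᴴ) = T * Tᴴ :=
    CFC.sqrt_mul_sqrt_self _ (posSemidef_self_mul_conjTranspose T).nonneg
  have h0 := norm_sq_inner_le_abs_mul_abs_conjTranspose T x x
  set P := CFC.sqrt (Tᴴ * T) with hPdef
  set Q := CFC.sqrt (T * Tᴴ) with hQdef
  set a := RCLike.re (star x ⬝ᵥ (P *ᵥ x)) with ha
  set b := RCLike.re (star x ⬝ᵥ (Q *ᵥ x)) with hb
  have h1 : a * b ≤ ((a + b) / 2) ^ 2 := by nlinarith [sq_nonneg (a - b)]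
  have h2 : a + b = RCLike.re (star x ⬝ᵥ ((P + Q) *ᵥ x)) := by rw [add_mulVec, dotProduct_add, map_add]
  have h3 := re_sq_le_re_mul_self (hP.1.add hQ.1) hx
  have h4 : RCLike.re (star x ⬝ᵥ (((P + Q) * (P + Q)) *ᵥ x)) ≤
      2 * RCLike.re (star x ⬝ᵥ ((P * P + Q * Q) *ᵥ x)) := by
    have e : (P * P + Q * Q) + (P * P + Q * Q) - (P + Q) * (P + Q) = (P - Q)ᴴ * (P - Q) := by
      rw [conjTranspose_sub, hP.1.eq, hQ.1.eq]
      noncomm_ring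
    have hD : ((P * P + Q * Q) + (P * P + Q * Q) - (P + Q) * (P + Q)).PosSemidef := by
      rw [e]; exact posSemidef_conjTranspose_mul_self _
    have h := (RCLike.nonneg_iff.mp (hD.dotProduct_mulVec_nonneg x)).1
    rw [sub_mulVec, add_mulVec, dotProduct_sub, dotProduct_add, map_sub, map_add] at h
    linarith
  calc ‖star x ⬝ᵥ (T *ᵥ x)‖ ^ 2 ≤ a * b := h0
    _ ≤ ((a + b) / 2) ^ 2 := h1
    _ = RCLike.re (star x ⬝ᵥ ((P + Q) *ᵥ x)) ^ 2 / 4 := by rw [h2]; ring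
    _ ≤ RCLike.re (star x ⬝ᵥ (((P + Q) * (P + Q)) *ᵥ x)) / 4 := by gcongr
    _ ≤ 2 * RCLike.re (star x ⬝ᵥ ((P * P + Q * Q) *ᵥ x)) / 4 := by gcongr
    _ = 1 / 2 * RCLike.re (star x ⬝ᵥ ((Tᴴ * T + T * Tᴴ) *ᵥ x)) := by rw [hPP, hQQ]; ring

/-- **Kittaneh (2005), right half of (1.9) read def-free over `ℂ`: `|⟨Tx, x⟩|² ≤ ½‖T^*T + TT^*‖` for every unit
vector `x`**, `‖·‖` the `ℓ²`-operator (spectral) norm; hence `w²(T) ≤ ½‖T^*T + TT^*‖`. [cite: Kittaneh2005, Thm 1;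
Alomari2019, eq. (1.9)] -/
theorem kittaneh_norm_sq_inner_le_l2_opNorm {n : Type*} [Fintype n] [DecidableEq n] (T : Matrix n n ℂ)
    {x : n → ℂ} (hx : star x ⬝ᵥ x = 1) :
    ‖star x ⬝ᵥ (T *ᵥ x)‖ ^ 2 ≤
      1 / 2 * ‖(toEuclideanLin (𝕜 := ℂ) (m := n) (n := n)).trans LinearMap.toContinuousLinearMap
        (Tᴴ * T + T * Tᴴ)‖ := by
  have h := kittaneh_norm_sq_inner_le T hx
  have h2 := NumericalRadiusShiftExamples.norm_star_dotProduct_mulVec_le_l2_opNorm (Tᴴ * T + T * Tᴴ) hx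
  exact h.trans (by gcongr; exact (RCLike.re_le_norm _).trans h2)

end Kittaneh

end Literature.LinearAlgebra.Matrix.HolderMcCarthyInequality
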